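import Summits.CriticalPhenomena.SAWScalingLimit.Theorems.SAWDevelopingMapObservableToSLETypeLadderCarvedReductionSqueezeGateFacts
import Summits.CriticalPhenomena.SAWScalingLimit.Theorems.SAWDevelopingMapObservableToSLETypeLadderCarvedReductionSqueezeMiddleWalk
import Summits.CriticalPhenomena.SAWScalingLimit.Theorems.SAWDevelopingMapObservableToSLETypeLadderCarvedReductionSqueezeWalkOffZones
import Summits.CriticalPhenomena.SAWScalingLimit.Theorems.SAWDefectDecoherenceObservableToSLERNestedLinkDefs
import HarnessLib

/-!
# The bulk LINK of the framed super-domain: the middle section of the realised SAW, pinned, joins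
# the two gates' bulk points off the corridors and the frame rectangles (piece (T-A′ P2-link) of
# stub T-A′ `stub_carvedReduction_squeezeGeometry_domains`)

Crux `SAWDevelopingMap.ObservableToSLE` (stmt-CriticalPhenomena-10472), line `six-class-type-ladder`,
stub T-A′ `stub_carvedReduction_squeezeGeometry_domains`.  Landing target:
`Summits/CriticalPhenomena/SAWScalingLimit/Theorems/SAWDevelopingMapObservableToSLETypeLadderCarvedReductionSqueezeLinkSup.lean`
(`--supports stmt-CriticalPhenomena-10472`; registered carrier `stub_carvedReduction_linkSup`).
Composition of `firstGoodGateN_facts` (p144696), `exists_middleWalk` (p143736) and the conclusion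
of `stub_carvedReduction_walkOffZones` (p144234, taken verbatim as a hypothesis).

Hypothesis `hlink` of `stub_carvedReduction_superFrame` (p144884): the bulk points
`b i = P i + (ρw/2) i` of the two gates are joined inside `J` off both corridors `O i` and both
frame rectangles `R i`.  At a large level `j` (index `κ j` of the hypothesis `hgates` of T-A′): the
realised SAW `γ` first leaves `S (n)` through the gate `q` and `T (n')` (reversed) through `q'`,
never returning; `q' ∉ S (n)`; so its middle section is a walk `q ⇝ q'` of `D_{s_j}` off
`U_j = S (n) ∪ T (n')` (`exists_middleWalk`), whose pinned polyline runs in `J ∖ X`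
(`…WalkOffZones`), `X ⊇ O 0 ∪ O 1 ∪ R 0 ∪ R 1`; the pinned gates tend to `P i` from above, hence
lie eventually in the open upper half-discs `{im > im (P i)} ∩ ball (P i) ρw`, which are convex,
contain `b i`, and lie in `J` off the corridors and rectangles.
-/

noncomputable section

open scoped Topology
open Filter Set Metric
open Literature.Probability.LatticeModels (HexVertex hexGraph hexCenter triEmbed Site)
open Literature.Probability.RandomPlanarGeometry
open Literature.Probability.RandomPlanarGeometry.SAW

namespace Summit.CriticalPhenomena.SAWScalingLimit.Theorems.ObservableToSLE.TypeLadder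

open Summit.CriticalPhenomena.SAWScalingLimit.Theorems.ObservableToSLER.NestedGate

/-- The pinned gate, converging to `P` strictly from above, lies eventually in the open upper
half-disc of radius `ρw` at `P`. -/
theorem eventually_mem_upperHalfDisc {u : ℕ → ℂ} {P : ℂ} {ρw : ℝ} (hρw : 0 < ρw)
    (hconv : Tendsto u atTop (𝓝 P)) (habove : ∀ j, P.im < (u j).im) :
    ∀ᶠ j in atTop, u j ∈ {z : ℂ | P.im < z.im} ∩ ball P ρw := by
  filter_upwards [hconv.eventually (isOpen_ball.mem_nhds (mem_ball_self hρw))] with j hj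
  exact ⟨habove j, hj⟩

/-- The bulk point `P + (ρw/2) i` lies in the open upper half-disc of radius `ρw` at `P`. -/
theorem bulkPoint_mem_upperHalfDisc (P : ℂ) {ρw : ℝ} (hρw : 0 < ρw) :
    P + ((ρw / 2 : ℝ) : ℂ) * Complex.I ∈ {z : ℂ | P.im < z.im} ∩ ball P ρw := by
  refine ⟨by show P.im < (P + ((ρw / 2 : ℝ) : ℂ) * Complex.I).im; simp; positivity, ?_⟩
  rw [mem_ball, dist_eq_norm, add_sub_cancel_left, norm_mul, Complex.norm_real, Complex.norm_I, mul_one,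
    Real.norm_of_nonneg (by positivity)]
  linarith

/-- **Registered carrier `stub_carvedReduction_linkSup`** (crux item stmt-CriticalPhenomena-10472,
stub T-A′ `stub_carvedReduction_squeezeGeometry_domains`, piece THE BULK LINK); see the module
docstring.  `Avoid` is the complement target (`J ∖ X` of `…WalkOffZones`), `Good` the set required
by `superFrame` (`J ∖ (O 0 ∪ O 1 ∪ R 0 ∪ R 1)`). -/
theorem stub_carvedReduction_linkSup :
    ∀ (D : DobrushinDomain) (a b : ℝ → HexVertex) (δ : ℕ → ℝ) (ρ R : ℝ) (S T : ℕ → ℕ → Set HexVertex) (n n' : ℕ → ℕ)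
      (q q' : ℕ → HexVertex) (κ : ℕ → ℕ) (x : ℕ → Site 2) (P : Fin 2 → ℂ) (ρw : ℝ) (Avoid Good : Set ℂ),
      (∀ k, ∃ (γ : HexDomainSAW D.carrier (δ k) (a (δ k)) (b (δ k))) (m : ℕ) (p : HexVertex) (m' : ℕ) (p' : HexVertex),
        IsFirstGoodGateN D.carrier (δ k) ρ R (S k) (a (δ k)) γ.walk.support (n k) m p (q k) ∧
        IsFirstGoodGateN D.carrier (δ k) ρ R (T k) (b (δ k)) γ.walk.support.reverse (n' k) m' p' (q' k) ∧
        WideLink D.carrier (δ k) ρ (S k (n k) ∪ T k (n' k)) (q k) (q' k)) →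
      (∀ᶠ j in atTop, q' (κ j) ∉ S (κ j) (n (κ j))) →
      (∀ᶠ j in atTop, ∀ (u v : HexVertex) (w : (hexDomainGraph D.carrier (δ (κ j))).Walk u v),
        (∀ y ∈ w.support, y ∉ S (κ j) (n (κ j)) ∪ T (κ j) (n' (κ j))) → ((δ (κ j) : ℝ) : ℂ) * hexCenter u ∈ closure D.carrier →
        JoinedIn Avoid (((δ (κ j) : ℝ) : ℂ) * hexCenter u - ((δ (κ j) : ℝ) : ℂ) * triEmbed (x j))
          (((δ (κ j) : ℝ) : ℂ) * hexCenter v - ((δ (κ j) : ℝ) : ℂ) * triEmbed (x j))) →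
      Avoid ⊆ Good → 0 < ρ → 0 < ρw →
      (∀ i, {z : ℂ | (P i).im < z.im} ∩ ball (P i) ρw ⊆ Good) →
      Tendsto (fun j => ((δ (κ j) : ℝ) : ℂ) * hexCenter (q (κ j)) - ((δ (κ j) : ℝ) : ℂ) * triEmbed (x j)) atTop (𝓝 (P 0)) →
      Tendsto (fun j => ((δ (κ j) : ℝ) : ℂ) * hexCenter (q' (κ j)) - ((δ (κ j) : ℝ) : ℂ) * triEmbed (x j)) atTop (𝓝 (P 1)) →
      (∀ j, (P 0).im < (((δ (κ j) : ℝ) : ℂ) * hexCenter (q (κ j)) - ((δ (κ j) : ℝ) : ℂ) * triEmbed (x j)).im) →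
      (∀ j, (P 1).im < (((δ (κ j) : ℝ) : ℂ) * hexCenter (q' (κ j)) - ((δ (κ j) : ℝ) : ℂ) * triEmbed (x j)).im) →
      JoinedIn Good (P 0 + ((ρw / 2 : ℝ) : ℂ) * Complex.I) (P 1 + ((ρw / 2 : ℝ) : ℂ) * Complex.I) := by
  intro D a b δ ρ R S T n n' q q' κ x P ρw Avoid Good hgates hq'S hwalk hAG hρ hρw hdisc hconv hconv' habove habove'
  obtain ⟨j, hjq', hjw, hjq, hjq''⟩ := (hq'S.and (hwalk.and ((eventually_mem_upperHalfDisc hρw hconv habove).and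
    (eventually_mem_upperHalfDisc hρw hconv' habove')))).exists
  obtain ⟨γ, m, p, m', p', hgS, hgT, -⟩ := hgates (κ j)
  -- the first good gates, along the walk and along the reversed walk
  obtain ⟨-, -, hcleanq, hexitS, hnoS⟩ := firstGoodGateN_facts γ.walk hgS
  have hgT' : IsFirstGoodGateN D.carrier (δ (κ j)) ρ R (T (κ j)) (b (δ (κ j))) γ.walk.reverse.support (n' (κ j)) m' p' (q' (κ j)) := by
    rwa [SimpleGraph.Walk.support_reverse]
  obtain ⟨-, -, -, hexitT, hnoT⟩ := firstGoodGateN_facts γ.walk.reverse hgT'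
  rw [SimpleGraph.Walk.support_reverse] at hexitT hnoT
  -- the middle section
  obtain ⟨w, hw⟩ := exists_middleWalk γ.walk hexitS hnoS hexitT hnoT hjq'
  have hwU : ∀ y ∈ w.support, y ∉ S (κ j) (n (κ j)) ∪ T (κ j) (n' (κ j)) := by
    rintro y hy (h | h)
    · exact (hw y hy).2.1 h
    · exact (hw y hy).2.2 h
  -- the gate centre lies in `D` (the clean window ball), hence in `closure D`
  have hqD : ((δ (κ j) : ℝ) : ℂ) * hexCenter (q (κ j)) ∈ closure D.carrier :=
    subset_closure (hcleanq (mem_closedBall_self hρ.le))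
  have hmid := hjw _ _ w hwU hqD
  -- the two end segments inside the open upper half-discs
  have hseg0 : JoinedIn Good (P 0 + ((ρw / 2 : ℝ) : ℂ) * Complex.I)
      (((δ (κ j) : ℝ) : ℂ) * hexCenter (q (κ j)) - ((δ (κ j) : ℝ) : ℂ) * triEmbed (x j)) :=
    JoinedIn.of_segment_subset ((((convex_halfSpace_im_gt _).inter (convex_ball _ _)).segment_subset
      (bulkPoint_mem_upperHalfDisc (P 0) hρw) hjq).trans (hdisc 0))
  have hseg1 : JoinedIn Good (((δ (κ j) : ℝ) : ℂ) * hexCenter (q' (κ j)) - ((δ (κ j) : ℝ) : ℂ) * triEmbed (x j))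
      (P 1 + ((ρw / 2 : ℝ) : ℂ) * Complex.I) :=
    JoinedIn.of_segment_subset ((((convex_halfSpace_im_gt _).inter (convex_ball _ _)).segment_subset
      hjq'' (bulkPoint_mem_upperHalfDisc (P 1) hρw)).trans (hdisc 1))
  exact (hseg0.trans (hmid.mono hAG)).trans hseg1

end Summit.CriticalPhenomena.SAWScalingLimit.Theorems.ObservableToSLE.TypeLadder

end
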